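import Literature.NumberTheory.EllipticCurves.BinaryQuarticForms
import Mathlib.LinearAlgebra.Matrix.Adjugate
import Mathlib.Algebra.Polynomial.Roots
import Mathlib.Algebra.CubicDiscriminant
import HarnessLib

/-!
# The stabiliser of a binary quartic form in `PGL₂(K)` and the rational roots of its cubic resolvent

Topic `Literature/NumberTheory/EllipticCurves`; companion of `BinaryQuarticForms.lean` (vocabulary
of M. Bhargava, A. Shankar, *Binary quartic forms having bounded invariants, and the boundedness of
the average rank of elliptic curves*, Ann. of Math. (2) 181 (2015) 191–242).

For a field `K` with `2 ≠ 0`, `3 ≠ 0` and a binary quartic form `f ∈ V_K` of nonzero discriminant,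
consider the *twisted* action `γ · f = (det γ)⁻² f((x,y)γ)` of `GL₂(K)` (scalars act trivially, so
this is an action of `PGL₂(K)` preserving `I` and `J`; `BinaryQuartic.PGL2Equiv`). We prove

* `BinaryQuartic.pgl2StabilizerCard_eq`: **the stabiliser of `f` in `PGL₂(K)` has exactly
  `1 + #{φ ∈ K : φ³ − 3 I(f) φ + J(f) = 0}` elements** — one more than the number of `K`-rational
  roots of the cubic resolvent of `f`.

Since `x ↦ −3x` carries the roots of `x³ − (I/3)x − J/27` (the `2`-division cubic of the curve
`E_{I,J} : y² = x³ − (I/3)x − J/27` "having invariants `I` and `J`") onto those of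
`φ³ − 3Iφ + J`, the right-hand side is `#E_{I,J}(K)[2]`; this is the content of Bhargava–Shankar's
Lemma 5.11 (held arXiv text `arXiv:1006.1002v2`; Thm 3.2 of the published version): "the size of
the stabilizer of `f` in `PGL₂(K)` is equal to `#E(K)[2]`", stated there for `I ≠ 0`, `J ≠ 0`
and derived from the geometry of `2`-coverings; and, over `K = ℝ`, of Lemma 2.2 (the stabiliser in
`GL₂(ℝ)` has order `8` or `4` according as `Δ > 0` or `Δ < 0`). The proof here is direct and
algebraic and needs only `Δ(f) ≠ 0`:

1. (`trace_eq_zero_of_mem_stabilizerSet`) A non-scalar `γ` with `γ · f = f` is an involution of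
   `ℙ¹`, i.e. `tr γ = 0`: conjugating `γ` to its companion matrix `C = (0 1; −n τ)`, a `C`-stable
   form with `τ ≠ 0` is forced to be `(e/n²)(x² + τxy + ny²)²`, of discriminant `0`.
2. (`phiOf_spec`) To a trace-zero stabilising `γ = (s t; u −s)`
   with fixed-point form `h_γ = t x² − 2s xy − u y²` attach `φ(γ) = (f, h_γ²)₄ · 3/(s² + tu)`
   (fourth transvectant). Then `φ(γ)` is a root of the resolvent and
   `g₄(f) + 4φ(γ) f = ((φ(γ)² − I)/(s² + tu)) · h_γ²` (`g₄` the quartic covariant), both read off in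
   the normal form `γ = C`, `f = (a, b, c, −nb, n²a)`, where `φ = −c − 6na`, and transported by the
   covariance of `(·,·)₄`, `g₄` and `h_γ`.
3. (`exists_smul_eq_of_phiOf_eq`) Hence `γ` is recovered from `φ(γ)` up to scalars (`h_γ²`, and
   with it `h_γ`, is determined by `φ(γ)` through the square identity, as `φ² ≠ I` when `Δ ≠ 0`):
   `γ ↦ φ(γ)` is injective on `PGL₂`-stabiliser elements `≠ 1`.
4. (`nMatrix_mem_stabilizerSet`, `phiOf_nMatrix`) Conversely every root `φ` is `φ(N_φ)` for an
   explicit stabilising involution `N_φ`, written in depressed coordinates `f = (a, 0, c, d, e)`,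
   `a ≠ 0` (`N_φ = (9ad 6a(φ−2c); (φ−2c)(φ+c) −9ad)`, or `diag(1,−1)` if `φ = 2c`), reached by a
   preliminary `PGL₂(K)`-change of variables (`exists_twist_depressed`). Counting classes modulo
   scalars gives `pgl2StabilizerCard_eq` (and `pgl2StabilizerCard_le_four`).

## References

* M. Bhargava, A. Shankar, Ann. of Math. (2) 181 (2015) 191–242 = arXiv:1006.1002, Lemma 2.2 and
  Lemmas 5.10–5.11 of the arXiv v2 text (Thm 3.2 of the published version).
  [cite: BhargavaShankarAnnals2015, Lemma 5.11 (arXiv:1006.1002v2 numbering)]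
* J. E. Cremona, *Classical invariants and 2-descent on elliptic curves*, J. Symbolic Comput. 31
  (2001) 71–87, §2–3 (the covariants `g₄`, `g₆`, the cubic resolvent `φ³ − 3Iφ + J` and the
  quadratic factorisations attached to its roots) — background for the formulas.

## Design

`twist γ f` is the twisted action on all of `M₂(K)` (meaningful for `det γ ≠ 0`);
`stabilizerSet f = {γ : det γ ≠ 0, γ · f = f}`; the "number of elements of the stabiliser in
`PGL₂(K)`" is `pgl2StabilizerCard f`, the number of classes of `stabilizerSet f` modulo `Kˣ`
(the `Set.ncard` of the set of classes, as for `BinaryQuartic.pgl2QClassCount`);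
`resolventRoots f = {φ | φ³ − 3I(f)φ + J(f) = 0}`. All polynomial identities are closed by `ring` /
`linear_combination` with integer certificates.
-/

noncomputable section

open scoped Classical
open Matrix

namespace Literature.NumberTheory.EllipticCurves

namespace BinaryQuartic

variable {K : Type*} [Field K]

/-! ## The twisted action, the stabiliser, the resolvent -/

/-- The twisted action `γ · f = (det γ)⁻² f((x,y)γ)` of `GL₂(K)` on `V_K` (Bhargava–Shankar, held
arXiv text §3.3 p. 15 and §5.1: the action for which `PGL2Equiv f g ↔ ∃ γ, g = twist γ f`).
[cite: BhargavaShankarAnnals2015, §3.3 p. 15 (twisted action; arXiv:1006.1002v2 numbering)] -/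
def twist (γ : Matrix (Fin 2) (Fin 2) K) (f : BinaryQuartic K) : BinaryQuartic K :=
  (γ.det ^ 2)⁻¹ • f.subst γ

/-- The (exact) stabiliser of `f` for the twisted action: invertible matrices `γ` with `γ · f = f`
(a union of cosets of the scalars `Kˣ`). [cite: BhargavaShankarAnnals2015, Lemma 5.11 (stabilizer in PGL₂(K); arXiv:1006.1002v2 numbering)] -/
def stabilizerSet (f : BinaryQuartic K) : Set (Matrix (Fin 2) (Fin 2) K) :=
  {γ | γ.det ≠ 0 ∧ twist γ f = f}

/-- The class of `γ` modulo scalars inside the stabiliser: `{γ' ∈ Stab(f) | γ' = c γ}`. [folklore] -/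
def stabilizerClass (f : BinaryQuartic K) (γ : Matrix (Fin 2) (Fin 2) K) :
    Set (Matrix (Fin 2) (Fin 2) K) :=
  {γ' | γ' ∈ stabilizerSet f ∧ ∃ c : K, γ' = c • γ}

/-- **The number of elements of the stabiliser of `f` in `PGL₂(K)`**: the number of classes of
stabilising matrices modulo scalars (Bhargava–Shankar, Lemma 5.11: "the size of the stabilizer of
`f` in `PGL₂(K)`"). [cite: BhargavaShankarAnnals2015, Lemma 5.11 (arXiv:1006.1002v2 numbering)] -/
def pgl2StabilizerCard (f : BinaryQuartic K) : ℕ :=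
  (stabilizerClass f '' stabilizerSet f).ncard

/-- The `K`-rational roots of the cubic resolvent `φ³ − 3I(f)φ + J(f)` of `f` (Cremona 2001, §3;
its roots `φ` correspond to `x = −φ/3` on the `2`-division cubic `x³ − (I/3)x − J/27` of `E_{I,J}`).
[folklore] -/
def resolventRoots (f : BinaryQuartic K) : Set K :=
  {φ | φ ^ 3 - 3 * f.I * φ + f.J = 0}

/-! ## Addition of forms -/

omit [Field K] in
/-- Coefficientwise addition of binary quartic forms (the additive structure of `V_R = R⁵`). [folklore] -/
instance instAdd {R : Type*} [CommRing R] : Add (BinaryQuartic R) :=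
  ⟨fun f g ↦ ⟨f.a + g.a, f.b + g.b, f.c + g.c, f.d + g.d, f.e + g.e⟩⟩

omit [Field K] in
/-- Addition on the coefficient `a` (definitional). [folklore] -/
@[simp] theorem add_a {R : Type*} [CommRing R] (f g : BinaryQuartic R) : (f + g).a = f.a + g.a := rfl
omit [Field K] in
/-- Addition on the coefficient `b` (definitional). [folklore] -/
@[simp] theorem add_b {R : Type*} [CommRing R] (f g : BinaryQuartic R) : (f + g).b = f.b + g.b := rfl
omit [Field K] in
/-- Addition on the coefficient `c` (definitional). [folklore] -/
@[simp] theorem add_c {R : Type*} [CommRing R] (f g : BinaryQuartic R) : (f + g).c = f.c + g.c := rfl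
omit [Field K] in
/-- Addition on the coefficient `d` (definitional). [folklore] -/
@[simp] theorem add_d {R : Type*} [CommRing R] (f g : BinaryQuartic R) : (f + g).d = f.d + g.d := rfl
omit [Field K] in
/-- Addition on the coefficient `e` (definitional). [folklore] -/
@[simp] theorem add_e {R : Type*} [CommRing R] (f g : BinaryQuartic R) : (f + g).e = f.e + g.e := rfl

/-! ## Algebra of the twisted action -/

omit [Field K] in
/-- Substitution is additive in the form. [folklore] -/
theorem subst_add {R : Type*} [CommRing R] (f g : BinaryQuartic R) (γ : Matrix (Fin 2) (Fin 2) R) :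
    (f + g).subst γ = f.subst γ + g.subst γ := by
  ext <;> simp only [subst, add_a, add_b, add_c, add_d, add_e] <;> ring

/-- `twist` by a product: `(γ₁γ₂) · f = γ₁ · (γ₂ · f)` (a left action). [cite: BhargavaShankarAnnals2015, §2 p. 8 (left action)] -/
theorem twist_mul (γ₁ γ₂ : Matrix (Fin 2) (Fin 2) K) (f : BinaryQuartic K) :
    twist (γ₁ * γ₂) f = twist γ₁ (twist γ₂ f) := by
  simp only [twist, subst_mul, Matrix.det_mul, smul_subst, smul_smul, mul_pow, mul_inv]

/-- The identity acts trivially. [folklore] -/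
@[simp] theorem twist_one (f : BinaryQuartic K) : twist 1 f = f := by
  simp [twist]

/-- Scalars act trivially: `(cγ) · f = γ · f` for `c ≠ 0`. [folklore] -/
theorem twist_smul {c : K} (hc : c ≠ 0) (γ : Matrix (Fin 2) (Fin 2) K) (f : BinaryQuartic K) :
    twist (c • γ) f = twist γ f := by
  have hsub : f.subst (c • γ) = (c ^ 4) • f.subst γ := by
    ext <;> simp only [subst, Matrix.smul_apply, smul_eq_mul, smul_a, smul_b, smul_c, smul_d,
      smul_e] <;> ring
  simp only [twist, hsub, smul_smul, Matrix.det_smul, Fintype.card_fin]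
  congr 1
  field_simp

/-- `γ⁻¹ · (γ · f) = f` for invertible `γ`. [folklore] -/
theorem twist_inv_twist {γ : Matrix (Fin 2) (Fin 2) K} (hγ : γ.det ≠ 0) (f : BinaryQuartic K) :
    twist γ⁻¹ (twist γ f) = f := by
  rw [← twist_mul, Matrix.nonsing_inv_mul _ (isUnit_iff_ne_zero.mpr hγ), twist_one]

/-- `γ · (γ⁻¹ · f) = f` for invertible `γ`. [folklore] -/
theorem twist_twist_inv {γ : Matrix (Fin 2) (Fin 2) K} (hγ : γ.det ≠ 0) (f : BinaryQuartic K) :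
    twist γ (twist γ⁻¹ f) = f := by
  rw [← twist_mul, Matrix.mul_nonsing_inv _ (isUnit_iff_ne_zero.mpr hγ), twist_one]

/-- `twist γ` is injective for invertible `γ`. [folklore] -/
theorem twist_injective {γ : Matrix (Fin 2) (Fin 2) K} (hγ : γ.det ≠ 0) :
    Function.Injective (twist γ : BinaryQuartic K → BinaryQuartic K) := fun f g h ↦ by
  rw [← twist_inv_twist hγ f, h, twist_inv_twist hγ g]

/-- `twist γ` commutes with scaling of forms. [folklore] -/
theorem twist_smul_form (γ : Matrix (Fin 2) (Fin 2) K) (μ : K) (f : BinaryQuartic K) :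
    twist γ (μ • f) = μ • twist γ f := by
  simp only [twist, smul_subst, smul_smul, mul_comm]

/-- `twist γ` is additive. [folklore] -/
theorem twist_add (γ : Matrix (Fin 2) (Fin 2) K) (f g : BinaryQuartic K) :
    twist γ (f + g) = twist γ f + twist γ g := by
  simp only [twist, subst_add]
  ext <;> simp [mul_add]

/-- The twisted action preserves `I`. [cite: BhargavaShankarAnnals2015, §3.3 p. 15 (I, J invariant; arXiv:1006.1002v2 numbering)] -/
theorem I_twist {γ : Matrix (Fin 2) (Fin 2) K} (hγ : γ.det ≠ 0) (f : BinaryQuartic K) :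
    (twist γ f).I = f.I := by
  rw [twist, I_smul, I_subst, ← mul_assoc, inv_pow, ← pow_mul, inv_mul_cancel₀ (pow_ne_zero _ hγ),
    one_mul]

/-- The twisted action preserves `J`. [cite: BhargavaShankarAnnals2015, §3.3 p. 15 (I, J invariant; arXiv:1006.1002v2 numbering)] -/
theorem J_twist {γ : Matrix (Fin 2) (Fin 2) K} (hγ : γ.det ≠ 0) (f : BinaryQuartic K) :
    (twist γ f).J = f.J := by
  rw [twist, J_smul, J_subst, ← mul_assoc, inv_pow, ← pow_mul, inv_mul_cancel₀ (pow_ne_zero _ hγ),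
    one_mul]

/-- The twisted action preserves the discriminant (`27Δ = 4I³ − J²`, `3 ≠ 0`). [folklore] -/
theorem disc_twist (h3 : (3 : K) ≠ 0) {γ : Matrix (Fin 2) (Fin 2) K} (hγ : γ.det ≠ 0)
    (f : BinaryQuartic K) : (twist γ f).disc = f.disc := by
  have h27 : (27 : K) ≠ 0 := by
    have : (27 : K) = 3 * 3 * 3 := by norm_num
    rw [this]; exact mul_ne_zero (mul_ne_zero h3 h3) h3
  have h1 := twentySeven_mul_disc (twist γ f)
  have h2 := twentySeven_mul_disc f
  rw [I_twist hγ, J_twist hγ, ← h2] at h1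
  exact mul_left_cancel₀ h27 h1

/-- The resolvent is an invariant of the twisted action. [folklore] -/
theorem resolventRoots_twist {γ : Matrix (Fin 2) (Fin 2) K} (hγ : γ.det ≠ 0) (f : BinaryQuartic K) :
    resolventRoots (twist γ f) = resolventRoots f := by
  simp only [resolventRoots, I_twist hγ, J_twist hγ]

/-- Membership in the stabiliser, multiplied out: `det γ ≠ 0` and `f((x,y)γ) = (det γ)² f`. [folklore] -/
theorem mem_stabilizerSet_iff (f : BinaryQuartic K) (γ : Matrix (Fin 2) (Fin 2) K) :
    γ ∈ stabilizerSet f ↔ γ.det ≠ 0 ∧ f.subst γ = (γ.det ^ 2) • f := by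
  simp only [stabilizerSet, Set.mem_setOf_eq, twist]
  refine and_congr_right fun hγ ↦ ?_
  have h2 : γ.det ^ 2 ≠ 0 := pow_ne_zero _ hγ
  constructor
  · intro h
    rw [← h, smul_smul, mul_inv_cancel₀ h2, one_smul, h]
  · intro h
    rw [h, smul_smul, inv_mul_cancel₀ h2, one_smul]

/-- `1 ∈ Stab(f)`. [folklore] -/
theorem one_mem_stabilizerSet (f : BinaryQuartic K) : (1 : Matrix (Fin 2) (Fin 2) K) ∈ stabilizerSet f :=
  ⟨by simp, twist_one f⟩

/-- `Stab(f)` is stable under nonzero scalars. [folklore] -/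
theorem smul_mem_stabilizerSet_iff {c : K} (hc : c ≠ 0) (f : BinaryQuartic K)
    (γ : Matrix (Fin 2) (Fin 2) K) : c • γ ∈ stabilizerSet f ↔ γ ∈ stabilizerSet f := by
  simp only [stabilizerSet, Set.mem_setOf_eq, twist_smul hc, Matrix.det_smul, Fintype.card_fin,
    mul_ne_zero_iff, pow_ne_zero_iff (two_ne_zero), ne_eq, hc, not_false_eq_true, true_and]

/-- `0 ∉ Stab(f)`, so proportionality constants inside `Stab(f)` are nonzero. [folklore] -/
theorem ne_zero_of_smul_mem_stabilizerSet {c : K} {f : BinaryQuartic K} {γ : Matrix (Fin 2) (Fin 2) K}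
    (h : c • γ ∈ stabilizerSet f) : c ≠ 0 := by
  rintro rfl
  exact h.1 (by simp)

/-- Conjugation transports stabilisers: `γ ∈ Stab(f) ↔ PγP⁻¹ ∈ Stab(P · f)`. [folklore] -/
theorem conj_mem_stabilizerSet_iff {P : Matrix (Fin 2) (Fin 2) K} (hP : P.det ≠ 0) (f : BinaryQuartic K)
    (γ : Matrix (Fin 2) (Fin 2) K) : P * γ * P⁻¹ ∈ stabilizerSet (twist P f) ↔ γ ∈ stabilizerSet f := by
  have hPu : IsUnit P.det := isUnit_iff_ne_zero.mpr hP
  have hdet : (P * γ * P⁻¹).det = γ.det := by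
    rw [Matrix.det_mul, Matrix.det_mul, Matrix.det_nonsing_inv, Ring.inverse_eq_inv',
      mul_comm (P.det * γ.det), ← mul_assoc, inv_mul_cancel₀ hP, one_mul]
  simp only [stabilizerSet, Set.mem_setOf_eq, hdet]
  refine and_congr_right fun hγ ↦ ?_
  rw [twist_mul, twist_mul, twist_inv_twist hP]
  exact (twist_injective hP).eq_iff

/-! ## Companion matrices: conjugation and the shape of stable forms -/

/-- A non-scalar `2 × 2` matrix is conjugate to its companion matrix:
`P γ = (0 1; −det γ, tr γ) P` for some invertible `P` (take the rows `v`, `vγ` of a cyclic vector).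
[folklore] -/
theorem exists_mul_eq_companion_mul (γ : Matrix (Fin 2) (Fin 2) K)
    (hns : ¬ ∃ c : K, γ = c • (1 : Matrix (Fin 2) (Fin 2) K)) :
    ∃ P : Matrix (Fin 2) (Fin 2) K, P.det ≠ 0 ∧
      P * γ = !![0, 1; -γ.det, γ 0 0 + γ 1 1] * P := by
  by_cases h01 : γ 0 1 ≠ 0
  · refine ⟨!![1, 0; γ 0 0, γ 0 1], ?_, ?_⟩
    · simp [Matrix.det_fin_two, h01]
    · ext i j
      fin_cases i <;> fin_cases j <;>
        simp [Matrix.mul_apply, Fin.sum_univ_two, Matrix.det_fin_two] <;> ring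
  by_cases h10 : γ 1 0 ≠ 0
  · refine ⟨!![0, 1; γ 1 0, γ 1 1], ?_, ?_⟩
    · simp [Matrix.det_fin_two, h10]
    · ext i j
      fin_cases i <;> fin_cases j <;>
        simp [Matrix.mul_apply, Fin.sum_univ_two, Matrix.det_fin_two] <;> ring
  push Not at h01 h10
  have hne : γ 0 0 ≠ γ 1 1 := by
    intro heq
    apply hns
    refine ⟨γ 0 0, ?_⟩
    ext i j
    fin_cases i <;> fin_cases j <;> simp [h01, h10, heq]
  refine ⟨!![1, 1; γ 0 0, γ 1 1], ?_, ?_⟩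
  · simp only [Matrix.det_fin_two, Matrix.of_apply, Matrix.cons_val', Matrix.cons_val_zero,
      Matrix.cons_val_one, Matrix.cons_val_fin_one, one_mul]
    exact sub_ne_zero.mpr hne.symm
  · ext i j
    fin_cases i <;> fin_cases j <;>
      simp [Matrix.mul_apply, Fin.sum_univ_two, Matrix.det_fin_two, h01, h10] <;> ring

/-- The coefficients of `f((x,y)C)` for the companion matrix `C = (0 1; −n τ)`. [folklore] -/
theorem subst_companion (f : BinaryQuartic K) (n τ : K) :
    f.subst !![0, 1; -n, τ] =
      ⟨f.e, -f.d * n + 4 * f.e * τ, f.c * n ^ 2 - 3 * f.d * n * τ + 6 * f.e * τ ^ 2,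
        -f.b * n ^ 3 + 2 * f.c * n ^ 2 * τ - 3 * f.d * n * τ ^ 2 + 4 * f.e * τ ^ 3,
        f.a * n ^ 4 - f.b * n ^ 3 * τ + f.c * n ^ 2 * τ ^ 2 - f.d * n * τ ^ 3 + f.e * τ ^ 4⟩ := by
  ext <;> simp [subst] <;> ring

/-- The determinant of the companion matrix `(0 1; −n τ)` is `n`. [folklore] -/
theorem det_companion (n τ : K) : (!![0, 1; -n, τ] : Matrix (Fin 2) (Fin 2) K).det = n := by
  simp [Matrix.det_fin_two]

/-- **A form stable under a companion matrix of nonzero trace is a constant times a square, hence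
has discriminant zero**: if `C = (0 1; −n τ)`, `n ≠ 0`, `τ ≠ 0` and `C · f = f` then
`f = (e/n²)(x² + τxy + ny²)²` and `Δ(f) = 0` (`2 ≠ 0`, `3 ≠ 0`). [folklore] -/
theorem disc_eq_zero_of_companion_mem_stabilizerSet (h2 : (2 : K) ≠ 0) (h3 : (3 : K) ≠ 0)
    {f : BinaryQuartic K} {n τ : K} (hn : n ≠ 0) (hτ : τ ≠ 0)
    (h : (!![0, 1; -n, τ] : Matrix (Fin 2) (Fin 2) K) ∈ stabilizerSet f) : f.disc = 0 := by
  rw [mem_stabilizerSet_iff, det_companion, subst_companion] at h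
  obtain ⟨-, h⟩ := h
  have ha := congrArg BinaryQuartic.a h
  have hb := congrArg BinaryQuartic.b h
  have hc := congrArg BinaryQuartic.c h
  have hd := congrArg BinaryQuartic.d h
  simp only [smul_a, smul_b, smul_c, smul_d] at ha hb hc hd
  -- from the `c`-equation: `3τ(2eτ − dn) = 0`
  have hd' : f.d * n = 2 * f.e * τ := by
    have h6 : 3 * τ * (2 * f.e * τ - f.d * n) = 0 := by linear_combination hc
    rcases mul_eq_zero.mp h6 with h7 | h7
    · exact absurd h7 (mul_ne_zero h3 hτ)
    · linear_combination -h7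
  have hd'' : f.d = 2 * f.e * τ / n := by field_simp; linear_combination hd'
  have hb' : f.b = 2 * f.e * τ / n ^ 2 := by
    field_simp
    linear_combination -hb - hd'
  have ha' : f.a = f.e / n ^ 2 := by field_simp; linear_combination -ha
  have hc' : f.c = f.e * (2 * n + τ ^ 2) / n ^ 2 := by
    have h8 : 2 * τ * (f.c * n ^ 2 - f.e * (2 * n + τ ^ 2)) = 0 := by
      linear_combination hd - n * hb + 3 * τ ^ 2 * hd'
    rcases mul_eq_zero.mp h8 with h9 | h9
    · exact absurd h9 (mul_ne_zero h2 hτ)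
    · field_simp; linear_combination h9
  simp only [disc]
  rw [ha', hb', hc', hd'']
  field_simp
  ring

/-- **Shape of a form stable under a trace-zero companion matrix**: if `C = (0 1; −n 0)`, `n ≠ 0`,
`C · f = f`, then `e = n²a` and `d = −nb`. [folklore] -/
theorem shape_of_companion_mem_stabilizerSet {f : BinaryQuartic K} {n : K} (hn : n ≠ 0)
    (h : (!![0, 1; -n, 0] : Matrix (Fin 2) (Fin 2) K) ∈ stabilizerSet f) :
    f.e = n ^ 2 * f.a ∧ f.d = -n * f.b := by
  rw [mem_stabilizerSet_iff, det_companion, subst_companion] at h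
  obtain ⟨-, h⟩ := h
  have ha := congrArg BinaryQuartic.a h
  have hb := congrArg BinaryQuartic.b h
  simp only [smul_a, smul_b, mul_zero, add_zero] at ha hb
  refine ⟨by linear_combination ha, ?_⟩
  have : n * (f.d + n * f.b) = 0 := by linear_combination -hb
  rcases mul_eq_zero.mp this with h1 | h1
  · exact absurd h1 hn
  · linear_combination h1

/-- **A non-scalar stabilising matrix has trace zero** (it is an involution of `ℙ¹`), provided
`Δ(f) ≠ 0`, `2 ≠ 0`, `3 ≠ 0`. [folklore] -/
theorem trace_eq_zero_of_mem_stabilizerSet (h2 : (2 : K) ≠ 0) (h3 : (3 : K) ≠ 0)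
    {f : BinaryQuartic K} (hΔ : f.disc ≠ 0) {γ : Matrix (Fin 2) (Fin 2) K}
    (hγ : γ ∈ stabilizerSet f) (hns : ¬ ∃ c : K, γ = c • (1 : Matrix (Fin 2) (Fin 2) K)) :
    γ 0 0 + γ 1 1 = 0 := by
  by_contra hτ
  obtain ⟨P, hP, hconj⟩ := exists_mul_eq_companion_mul γ hns
  have hPu : IsUnit P.det := isUnit_iff_ne_zero.mpr hP
  have hC : P * γ * P⁻¹ = !![0, 1; -γ.det, γ 0 0 + γ 1 1] := by
    rw [hconj, Matrix.mul_assoc, Matrix.mul_nonsing_inv _ hPu, Matrix.mul_one]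
  have hmem : (!![0, 1; -γ.det, γ 0 0 + γ 1 1] : Matrix (Fin 2) (Fin 2) K) ∈
      stabilizerSet (twist P f) := by
    rw [← hC]; exact (conj_mem_stabilizerSet_iff hP f γ).mpr hγ
  have h0 := disc_eq_zero_of_companion_mem_stabilizerSet h2 h3 hγ.1 hτ hmem
  rw [disc_twist h3 hP] at h0
  exact hΔ h0


/-! ## Covariants: `g₄`, the fixed-point form of an involution, the fourth transvectant -/

/-- The quartic covariant `g₄(f) = (3b² − 8ac) x⁴ + 4(bc − 6ad) x³y + 2(2c² − 24ae − 3bd) x²y²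
+ 4(cd − 6be) xy³ + (3d² − 8ce) y⁴` (minus the Hessian; Cremona 2001, §2). [folklore] -/
def g4 (f : BinaryQuartic K) : BinaryQuartic K :=
  ⟨3 * f.b ^ 2 - 8 * f.a * f.c, 4 * (f.b * f.c - 6 * f.a * f.d),
    2 * (2 * f.c ^ 2 - 24 * f.a * f.e - 3 * f.b * f.d), 4 * (f.c * f.d - 6 * f.b * f.e),
    3 * f.d ^ 2 - 8 * f.c * f.e⟩

/-- The square `h_γ²` of the fixed-point quadratic form `h_γ = t x² − 2s xy − u y²` of a trace-zero
matrix `γ = (s t; u −s)` acting on `ℙ¹` by `[x:y] ↦ [(x,y)γ]` (only the entries `s, t, u` are used).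
[folklore] -/
def hsq (γ : Matrix (Fin 2) (Fin 2) K) : BinaryQuartic K :=
  ⟨γ 0 1 ^ 2, -4 * γ 0 0 * γ 0 1, 4 * γ 0 0 ^ 2 - 2 * γ 0 1 * γ 1 0, 4 * γ 0 0 * γ 1 0, γ 1 0 ^ 2⟩

/-- Twelve times the apolarity pairing (fourth transvectant) of two quartics:
`12 (f,g)₄ = 12 a e' − 3 b d' + 2 c c' − 3 d b' + 12 e a'`. [folklore] -/
def pairing12 (f g : BinaryQuartic K) : K :=
  12 * f.a * g.e - 3 * f.b * g.d + 2 * f.c * g.c - 3 * f.d * g.b + 12 * f.e * g.a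

/-- `s² + tu = −det γ` for a trace-zero `γ = (s t; u −s)` (a quarter of the discriminant of `h_γ`).
[folklore] -/
def dInv (γ : Matrix (Fin 2) (Fin 2) K) : K :=
  γ 0 0 ^ 2 + γ 0 1 * γ 1 0

/-- The resolvent root attached to a (trace-zero, stabilising) matrix:
`φ(γ) = 3 (f, h_γ²)₄ / (s² + tu) = 12(f,h_γ²)₄ / (4(s² + tu))`. [folklore] -/
def phiOf (f : BinaryQuartic K) (γ : Matrix (Fin 2) (Fin 2) K) : K :=
  pairing12 f (hsq γ) / (4 * dInv γ)

/-- `g₄` is a covariant: `g₄(f((x,y)P)) = (det P)² · g₄(f)((x,y)P)`. [folklore] -/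
theorem g4_subst (f : BinaryQuartic K) (P : Matrix (Fin 2) (Fin 2) K) :
    g4 (f.subst P) = (P.det ^ 2) • (g4 f).subst P := by
  ext <;> simp only [g4, subst, smul_a, smul_b, smul_c, smul_d, smul_e, Matrix.det_fin_two] <;> ring

/-- `g₄` is quadratic: `g₄(μ f) = μ² g₄(f)`. [folklore] -/
theorem g4_smul (μ : K) (f : BinaryQuartic K) : g4 (μ • f) = (μ ^ 2) • g4 f := by
  ext <;> simp only [g4, smul_a, smul_b, smul_c, smul_d, smul_e] <;> ring

/-- `g₄` commutes with the twisted action: `g₄(P · f) = P · g₄(f)`. [folklore] -/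
theorem g4_twist {P : Matrix (Fin 2) (Fin 2) K} (hP : P.det ≠ 0) (f : BinaryQuartic K) :
    g4 (twist P f) = twist P (g4 f) := by
  rw [twist, g4_smul, g4_subst, smul_smul, twist]
  congr 1
  field_simp

/-- The pairing is a joint invariant: `12(f∘P, g∘P)₄ = (det P)⁴ · 12(f,g)₄`. [folklore] -/
theorem pairing12_subst (f g : BinaryQuartic K) (P : Matrix (Fin 2) (Fin 2) K) :
    pairing12 (f.subst P) (g.subst P) = P.det ^ 4 * pairing12 f g := by
  simp only [pairing12, subst, Matrix.det_fin_two]; ring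

/-- The pairing is linear in the first slot. [folklore] -/
theorem pairing12_smul_left (μ : K) (f g : BinaryQuartic K) :
    pairing12 (μ • f) g = μ * pairing12 f g := by
  simp only [pairing12, smul_a, smul_b, smul_c, smul_d, smul_e]; ring

/-- The pairing is linear in the second slot. [folklore] -/
theorem pairing12_smul_right (μ : K) (f g : BinaryQuartic K) :
    pairing12 f (μ • g) = μ * pairing12 f g := by
  simp only [pairing12, smul_a, smul_b, smul_c, smul_d, smul_e]; ring

/-- `h_{cγ}² = c² h_γ²`. [folklore] -/
theorem hsq_smul (c : K) (γ : Matrix (Fin 2) (Fin 2) K) : hsq (c • γ) = (c ^ 2) • hsq γ := by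
  ext <;> simp only [hsq, Matrix.smul_apply, smul_eq_mul, smul_a, smul_b, smul_c, smul_d, smul_e] <;>
    ring

/-- `dInv (cγ) = c² dInv γ`. [folklore] -/
theorem dInv_smul (c : K) (γ : Matrix (Fin 2) (Fin 2) K) : dInv (c • γ) = c ^ 2 * dInv γ := by
  simp only [dInv, Matrix.smul_apply, smul_eq_mul]; ring

/-- `φ` is defined on `PGL₂`: `φ(cγ) = φ(γ)` for `c ≠ 0`. [folklore] -/
theorem phiOf_smul {c : K} (hc : c ≠ 0) (f : BinaryQuartic K) (γ : Matrix (Fin 2) (Fin 2) K) :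
    phiOf f (c • γ) = phiOf f γ := by
  simp only [phiOf, hsq_smul, dInv_smul, pairing12_smul_right]
  rw [mul_left_comm, mul_div_mul_left _ _ (pow_ne_zero 2 hc)]

/-- For trace-zero `γ`, `dInv γ = −det γ`. [folklore] -/
theorem dInv_eq_neg_det {γ : Matrix (Fin 2) (Fin 2) K} (htr : γ 1 1 = -γ 0 0) : dInv γ = -γ.det := by
  simp only [dInv, Matrix.det_fin_two, htr]; ring

/-- Covariance of the fixed-point form under conjugation: for a trace-zero `M = (s t; u −s)`,
`h_{P M adj(P)}² = h_M²((x,y)P)`. [folklore] -/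
theorem hsq_conj_adjugate (P : Matrix (Fin 2) (Fin 2) K) (s t u : K) :
    hsq (P * !![s, t; u, -s] * P.adjugate) = (hsq !![s, t; u, -s]).subst P := by
  ext <;> simp [hsq, subst, Matrix.adjugate_fin_two, Matrix.mul_apply, Fin.sum_univ_two] <;> ring

/-- `dInv (P M adj(P)) = (det P)² dInv M` for trace-zero `M`. [folklore] -/
theorem dInv_conj_adjugate (P : Matrix (Fin 2) (Fin 2) K) (s t u : K) :
    dInv (P * !![s, t; u, -s] * P.adjugate) = P.det ^ 2 * dInv !![s, t; u, -s] := by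
  simp [dInv, Matrix.adjugate_fin_two, Matrix.mul_apply, Fin.sum_univ_two, Matrix.det_fin_two]; ring

/-- Conjugates of trace-zero matrices have trace zero. [folklore] -/
theorem conj_adjugate_one_one (P : Matrix (Fin 2) (Fin 2) K) (s t u : K) :
    (P * !![s, t; u, -s] * P.adjugate) 1 1 = -(P * !![s, t; u, -s] * P.adjugate) 0 0 := by
  simp [Matrix.adjugate_fin_two, Matrix.mul_apply, Fin.sum_univ_two]; ring

/-- `P M P⁻¹ = (det P)⁻¹ (P M adj P)`. [folklore] -/
theorem conj_eq_smul_conj_adjugate (P M : Matrix (Fin 2) (Fin 2) K) :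
    P * M * P⁻¹ = P.det⁻¹ • (P * M * P.adjugate) := by
  rw [Matrix.inv_def, Ring.inverse_eq_inv', Matrix.mul_smul]

/-- Conjugates of trace-zero matrices by invertible `P` have trace zero. [folklore] -/
theorem conj_one_one {P : Matrix (Fin 2) (Fin 2) K} (s t u : K) :
    (P * !![s, t; u, -s] * P⁻¹) 1 1 = -(P * !![s, t; u, -s] * P⁻¹) 0 0 := by
  rw [conj_eq_smul_conj_adjugate]
  simp only [Matrix.smul_apply, smul_eq_mul, conj_adjugate_one_one, mul_neg]

/-- `dInv` is a conjugation invariant (for trace-zero matrices). [folklore] -/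
theorem dInv_conj {P : Matrix (Fin 2) (Fin 2) K} (hP : P.det ≠ 0) (s t u : K) :
    dInv (P * !![s, t; u, -s] * P⁻¹) = dInv !![s, t; u, -s] := by
  rw [conj_eq_smul_conj_adjugate, dInv_smul, dInv_conj_adjugate, ← mul_assoc, inv_pow, inv_mul_cancel₀
    (pow_ne_zero 2 hP), one_mul]

/-- **`h_γ²` is a covariant of the twisted action**: `P · h_M² = h_{PMP⁻¹}²`. [folklore] -/
theorem twist_hsq (P : Matrix (Fin 2) (Fin 2) K) (s t u : K) :
    twist P (hsq !![s, t; u, -s]) = hsq (P * !![s, t; u, -s] * P⁻¹) := by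
  rw [conj_eq_smul_conj_adjugate, hsq_smul, hsq_conj_adjugate, twist, inv_pow]

/-- **`φ` is an invariant of the twisted action**: `φ(P · f; PMP⁻¹) = φ(f; M)`. [folklore] -/
theorem phiOf_conj {P : Matrix (Fin 2) (Fin 2) K} (hP : P.det ≠ 0) (f : BinaryQuartic K) (s t u : K) :
    phiOf (twist P f) (P * !![s, t; u, -s] * P⁻¹) = phiOf f !![s, t; u, -s] := by
  rw [conj_eq_smul_conj_adjugate, phiOf_smul (inv_ne_zero hP)]
  simp only [phiOf, twist, hsq_conj_adjugate, dInv_conj_adjugate, pairing12_smul_left, pairing12_subst]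
  have h4 : P.det ^ 4 ≠ 0 := pow_ne_zero 4 hP
  have h2 : P.det ^ 2 ≠ 0 := pow_ne_zero 2 hP
  rw [show (P.det ^ 2)⁻¹ * (P.det ^ 4 * pairing12 f (hsq !![s, t; u, -s])) =
      P.det ^ 2 * pairing12 f (hsq !![s, t; u, -s]) by field_simp]
  rw [mul_left_comm, mul_div_mul_left _ _ h2]

/-! ## The normal form `γ = (0 1; −n 0)`, `f = (a, b, c, −nb, n²a)` -/

/-- **The resolvent root and the square identity in normal form.** If `C = (0 1; −n 0)`, `n ≠ 0`,
stabilises `f` then, with `φ₁ = −c − 6na`: `φ₁` is a root of the resolvent, `φ(f; C) = φ₁`, and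
`g₄(f) + 4φ₁ f = ((φ₁² − I)/dInv C) · h_C²` (`h_C = x² + n y²`). [folklore] -/
theorem companion_normal_form (h2 : (2 : K) ≠ 0) {f : BinaryQuartic K} {n : K} (hn : n ≠ 0)
    (h : (!![0, 1; -n, 0] : Matrix (Fin 2) (Fin 2) K) ∈ stabilizerSet f) :
    (-f.c - 6 * n * f.a) ∈ resolventRoots f ∧
      phiOf f !![0, 1; -n, 0] = -f.c - 6 * n * f.a ∧
        g4 f + (4 * (-f.c - 6 * n * f.a)) • f =
          (((-f.c - 6 * n * f.a) ^ 2 - f.I) / dInv !![0, 1; -n, 0]) • hsq !![0, 1; -n, 0] := by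
  obtain ⟨he, hd⟩ := shape_of_companion_mem_stabilizerSet hn h
  have h4 : (4 : K) ≠ 0 := by
    rw [show (4 : K) = 2 * 2 by norm_num]; exact mul_ne_zero h2 h2
  have hD : dInv (!![0, 1; -n, 0] : Matrix (Fin 2) (Fin 2) K) = -n := by
    simp [dInv]
  have hH : hsq (!![0, 1; -n, 0] : Matrix (Fin 2) (Fin 2) K) = ⟨1, 0, 2 * n, 0, n ^ 2⟩ := by
    ext <;> simp [hsq]
  have hn' : -n ≠ 0 := neg_ne_zero.mpr hn
  refine ⟨?_, ?_, ?_⟩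
  · simp only [resolventRoots, Set.mem_setOf_eq, I, J, he, hd]
    ring
  · rw [phiOf, hD, hH]
    simp only [pairing12, he]
    rw [div_eq_iff (mul_ne_zero h4 hn')]
    ring
  · rw [hD, hH]
    ext <;> simp only [g4, I, add_a, add_b, add_c, add_d, add_e, smul_a, smul_b, smul_c,
      smul_d, smul_e, he, hd] <;> field_simp <;> ring

/-! ## Transport: the resolvent root and the square identity for every stabilising involution -/

/-- A trace-zero matrix in the stabiliser is not a scalar. [folklore] -/
theorem not_scalar_of_trace_zero (h2 : (2 : K) ≠ 0) {f : BinaryQuartic K}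
    {γ : Matrix (Fin 2) (Fin 2) K} (hγ : γ ∈ stabilizerSet f) (htr : γ 1 1 = -γ 0 0) :
    ¬ ∃ c : K, γ = c • (1 : Matrix (Fin 2) (Fin 2) K) := by
  rintro ⟨c, rfl⟩
  simp only [Matrix.smul_apply, Matrix.one_apply_eq, smul_eq_mul, mul_one] at htr
  have hc : c = 0 := by
    have : 2 * c = 0 := by linear_combination htr
    exact (mul_eq_zero.mp this).resolve_left h2
  exact hγ.1 (by simp [hc])


/-- **The resolvent root and the square identity attached to a stabilising involution.** For
`γ ∈ Stab(f)` of trace zero: `φ(γ)` is a root of the cubic resolvent of `f`, and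
`g₄(f) + 4φ(γ) f = ((φ(γ)² − I(f))/(s² + tu)) · h_γ²`. [folklore] -/
theorem phiOf_spec (h2 : (2 : K) ≠ 0) {f : BinaryQuartic K} {γ : Matrix (Fin 2) (Fin 2) K}
    (hγ : γ ∈ stabilizerSet f) (htr : γ 1 1 = -γ 0 0) :
    phiOf f γ ∈ resolventRoots f ∧
      g4 f + (4 * phiOf f γ) • f = ((phiOf f γ ^ 2 - f.I) / dInv γ) • hsq γ := by
  obtain ⟨s, t, u, rfl⟩ : ∃ s t u : K, γ = !![s, t; u, -s] :=
    ⟨γ 0 0, γ 0 1, γ 1 0, by ext i j; fin_cases i <;> fin_cases j <;> simp [htr]⟩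
  obtain ⟨P, hP, hconj⟩ :=
    exists_mul_eq_companion_mul _ (not_scalar_of_trace_zero h2 hγ (by simp))
  have htr0 : (!![s, t; u, -s] : Matrix (Fin 2) (Fin 2) K) 0 0 +
      (!![s, t; u, -s] : Matrix (Fin 2) (Fin 2) K) 1 1 = 0 := by simp
  rw [htr0] at hconj
  set n := (!![s, t; u, -s] : Matrix (Fin 2) (Fin 2) K).det with hn_def
  have hn : n ≠ 0 := hγ.1
  have hPu : IsUnit P.det := isUnit_iff_ne_zero.mpr hP
  have hC : P * !![s, t; u, -s] * P⁻¹ = !![0, 1; -n, 0] := by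
    rw [hconj, Matrix.mul_assoc, Matrix.mul_nonsing_inv _ hPu, Matrix.mul_one]
  have hmem : (!![0, 1; -n, 0] : Matrix (Fin 2) (Fin 2) K) ∈ stabilizerSet (twist P f) := by
    rw [← hC]; exact (conj_mem_stabilizerSet_iff hP f _).mpr hγ
  obtain ⟨hroot, hphi, hstar⟩ := companion_normal_form h2 hn hmem
  set φ₁ := -(twist P f).c - 6 * n * (twist P f).a with hφ₁
  have hphi' : phiOf f !![s, t; u, -s] = φ₁ := by
    rw [← hphi, ← hC, phiOf_conj hP]
  refine ⟨?_, ?_⟩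
  · rw [hphi', ← resolventRoots_twist hP f]; exact hroot
  · rw [hphi']
    rw [I_twist hP, ← hC, dInv_conj hP, hC] at hstar
    have key : twist P (g4 f + (4 * φ₁) • f) =
        twist P (((φ₁ ^ 2 - f.I) / dInv !![s, t; u, -s]) • hsq !![s, t; u, -s]) := by
      rw [twist_add, twist_smul_form, ← g4_twist hP, twist_smul_form, twist_hsq, hC]
      exact hstar
    exact twist_injective hP key

/-- A root of the resolvent of a form with `Δ ≠ 0` is simple: `φ² ≠ I` (`3 ≠ 0`). [folklore] -/
theorem sq_sub_I_ne_zero (h3 : (3 : K) ≠ 0) {f : BinaryQuartic K} (hΔ : f.disc ≠ 0) {φ : K}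
    (hφ : φ ∈ resolventRoots f) : φ ^ 2 - f.I ≠ 0 := by
  intro hS
  have hR : φ ^ 3 - 3 * f.I * φ + f.J = 0 := hφ
  have h27 : (27 : K) ≠ 0 := by
    rw [show (27 : K) = 3 * 3 * 3 by norm_num]; exact mul_ne_zero (mul_ne_zero h3 h3) h3
  apply hΔ
  have h := twentySeven_mul_disc f
  have h0 : 4 * f.I ^ 3 - f.J ^ 2 = 0 := by
    linear_combination (-(3 * f.I * φ - φ ^ 3 + f.J)) * hR +
      ((φ ^ 2 - f.I) * (3 * f.I - (φ ^ 2 - f.I))) * hS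
  rw [h0] at h
  exact (mul_eq_zero.mp h).resolve_left h27

/-- **A stabilising involution is determined by its resolvent root**: two trace-zero elements of
`Stab(f)` with the same `φ` are proportional (`Δ(f) ≠ 0`). [folklore] -/
theorem exists_smul_eq_of_phiOf_eq (h2 : (2 : K) ≠ 0) (h3 : (3 : K) ≠ 0) {f : BinaryQuartic K}
    (hΔ : f.disc ≠ 0) {γ γ' : Matrix (Fin 2) (Fin 2) K}
    (hγ : γ ∈ stabilizerSet f) (htr : γ 1 1 = -γ 0 0)
    (hγ' : γ' ∈ stabilizerSet f) (htr' : γ' 1 1 = -γ' 0 0) (hφ : phiOf f γ' = phiOf f γ) :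
    ∃ c : K, γ' = c • γ := by
  obtain ⟨s, t, u, rfl⟩ : ∃ s t u : K, γ = !![s, t; u, -s] :=
    ⟨γ 0 0, γ 0 1, γ 1 0, by ext i j; fin_cases i <;> fin_cases j <;> simp [htr]⟩
  obtain ⟨s', t', u', rfl⟩ : ∃ s' t' u' : K, γ' = !![s', t'; u', -s'] :=
    ⟨γ' 0 0, γ' 0 1, γ' 1 0, by ext i j; fin_cases i <;> fin_cases j <;> simp [htr']⟩
  obtain ⟨hroot, hstar⟩ := phiOf_spec h2 hγ (by simp)
  obtain ⟨-, hstar'⟩ := phiOf_spec h2 hγ' (by simp)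
  rw [hφ] at hstar'
  set φ := phiOf f !![s, t; u, -s] with hφdef
  have hI : φ ^ 2 - f.I ≠ 0 := sq_sub_I_ne_zero h3 hΔ hroot
  have hD : dInv !![s, t; u, -s] ≠ 0 := by
    rw [dInv_eq_neg_det (by simp)]; exact neg_ne_zero.mpr hγ.1
  have hD' : dInv !![s', t'; u', -s'] ≠ 0 := by
    rw [dInv_eq_neg_det (by simp)]; exact neg_ne_zero.mpr hγ'.1
  set κ := (φ ^ 2 - f.I) / dInv !![s, t; u, -s] with hκdef
  set κ' := (φ ^ 2 - f.I) / dInv !![s', t'; u', -s'] with hκ'def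
  have hκ : κ ≠ 0 := div_ne_zero hI hD
  have hκ' : κ' ≠ 0 := div_ne_zero hI hD'
  have heq : κ • hsq !![s, t; u, -s] = κ' • hsq !![s', t'; u', -s'] := hstar.symm.trans hstar'
  have hA : κ * t ^ 2 = κ' * t' ^ 2 := by
    have := congrArg BinaryQuartic.a heq; simpa [hsq] using this
  have hB : κ * (s * t) = κ' * (s' * t') := by
    have := congrArg BinaryQuartic.b heq
    simp only [hsq, smul_b, Matrix.of_apply, Matrix.cons_val', Matrix.cons_val_zero,
      Matrix.cons_val_one, Matrix.cons_val_fin_one] at this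
    have h4 : (4 : K) ≠ 0 := by
      rw [show (4 : K) = 2 * 2 by norm_num]; exact mul_ne_zero h2 h2
    have : 4 * (κ * (s * t) - κ' * (s' * t')) = 0 := by linear_combination -this
    simpa [h4, sub_eq_zero] using this
  have hC : κ * (4 * s ^ 2 - 2 * t * u) = κ' * (4 * s' ^ 2 - 2 * t' * u') := by
    have := congrArg BinaryQuartic.c heq; simpa [hsq] using this
  have hDD : κ * (s * u) = κ' * (s' * u') := by
    have := congrArg BinaryQuartic.d heq
    simp only [hsq, smul_d, Matrix.of_apply, Matrix.cons_val', Matrix.cons_val_zero,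
      Matrix.cons_val_one, Matrix.cons_val_fin_one] at this
    have h4 : (4 : K) ≠ 0 := by
      rw [show (4 : K) = 2 * 2 by norm_num]; exact mul_ne_zero h2 h2
    have : 4 * (κ * (s * u) - κ' * (s' * u')) = 0 := by linear_combination this
    simpa [h4, sub_eq_zero] using this
  have hE : κ * u ^ 2 = κ' * u' ^ 2 := by
    have := congrArg BinaryQuartic.e heq; simpa [hsq] using this
  have hF : κ * (s ^ 2 + t * u) = κ' * (s' ^ 2 + t' * u') := by
    have h1 : κ * (s ^ 2 + t * u) = φ ^ 2 - f.I := by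
      rw [hκdef, dInv]; simp only [Matrix.of_apply, Matrix.cons_val', Matrix.cons_val_zero,
        Matrix.cons_val_one, Matrix.cons_val_fin_one]
      exact div_mul_cancel₀ _ (by simpa [dInv] using hD)
    have h1' : κ' * (s' ^ 2 + t' * u') = φ ^ 2 - f.I := by
      rw [hκ'def, dInv]; simp only [Matrix.of_apply, Matrix.cons_val', Matrix.cons_val_zero,
        Matrix.cons_val_one, Matrix.cons_val_fin_one]
      exact div_mul_cancel₀ _ (by simpa [dInv] using hD')
    rw [h1, h1']
  have h6 : (6 : K) ≠ 0 := by
    rw [show (6 : K) = 2 * 3 by norm_num]; exact mul_ne_zero h2 h3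
  have hS : κ * s ^ 2 = κ' * s' ^ 2 := by
    have : 6 * (κ * s ^ 2 - κ' * s' ^ 2) = 0 := by linear_combination hC + 2 * hF
    simpa [h6, sub_eq_zero] using this
  have hTU : κ * (t * u) = κ' * (t' * u') := by linear_combination hF - hS
  -- case analysis on which coordinate of `(s, t, u)` is nonzero
  by_cases ht : t = 0
  · subst ht
    have ht' : t' = 0 := by
      have : κ' * t' ^ 2 = 0 := by rw [← hA]; ring
      exact pow_eq_zero_iff (n := 2) (by norm_num) |>.mp ((mul_eq_zero.mp this).resolve_left hκ')
    subst ht'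
    by_cases hu : u = 0
    · subst hu
      have hs : s ≠ 0 := by
        have := hγ.1; simp [Matrix.det_fin_two] at this; exact this
      have hu' : u' = 0 := by
        have : κ' * u' ^ 2 = 0 := by rw [← hE]; ring
        exact pow_eq_zero_iff (n := 2) (by norm_num) |>.mp ((mul_eq_zero.mp this).resolve_left hκ')
      subst hu'
      refine ⟨s' / s, ?_⟩
      have hss : s' / s * s = s' := div_mul_cancel₀ s' hs
      ext i j
      fin_cases i <;> fin_cases j
      · show s' = s' / s * s; rw [hss]
      · show (0 : K) = s' / s * 0; rw [mul_zero]
      · show (0 : K) = s' / s * 0; rw [mul_zero]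
      · show -s' = s' / s * -s; rw [mul_neg, hss]
    · have hu' : u' ≠ 0 := by
        intro h0
        have : κ * u ^ 2 = 0 := by rw [hE, h0]; ring
        exact hu (pow_eq_zero_iff (n := 2) (by norm_num) |>.mp
          ((mul_eq_zero.mp this).resolve_left hκ))
      refine ⟨u' / u, ?_⟩
      have hs' : s' * u = u' * s := by
        have h1 : κ' * u' * (s' * u - u' * s) = 0 := by
          linear_combination (-u) * hDD + s * hE
        rcases mul_eq_zero.mp h1 with h1 | h1
        · exact absurd h1 (mul_ne_zero hκ' hu')
        · exact sub_eq_zero.mp h1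
      have hss : s' = u' / u * s := by field_simp; linear_combination hs'
      have huu : u' / u * u = u' := div_mul_cancel₀ u' hu
      ext i j
      fin_cases i <;> fin_cases j
      · show s' = u' / u * s; exact hss
      · show (0 : K) = u' / u * 0; rw [mul_zero]
      · show u' = u' / u * u; rw [huu]
      · show -s' = u' / u * -s; rw [mul_neg, hss]
  · have ht' : t' ≠ 0 := by
      intro h0
      have : κ * t ^ 2 = 0 := by rw [hA, h0]; ring
      exact ht (pow_eq_zero_iff (n := 2) (by norm_num) |>.mp ((mul_eq_zero.mp this).resolve_left hκ))
    refine ⟨t' / t, ?_⟩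
    have hs' : s' * t = t' * s := by
      have h1 : κ' * t' * (s' * t - t' * s) = 0 := by
        linear_combination (-t) * hB + s * hA
      rcases mul_eq_zero.mp h1 with h1 | h1
      · exact absurd h1 (mul_ne_zero hκ' ht')
      · exact sub_eq_zero.mp h1
    have hu' : u' * t = t' * u := by
      have h1 : κ' * t' * (u' * t - t' * u) = 0 := by
        linear_combination (-t) * hTU + u * hA
      rcases mul_eq_zero.mp h1 with h1 | h1
      · exact absurd h1 (mul_ne_zero hκ' ht')
      · exact sub_eq_zero.mp h1
    have hss : s' = t' / t * s := by field_simp; linear_combination hs'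
    have huu : u' = t' / t * u := by field_simp; linear_combination hu'
    have htt : t' / t * t = t' := div_mul_cancel₀ t' ht
    ext i j
    fin_cases i <;> fin_cases j
    · show s' = t' / t * s; exact hss
    · show t' = t' / t * t; rw [htt]
    · show u' = t' / t * u; exact huu
    · show -s' = t' / t * -s; rw [mul_neg, hss]

/-! ## Depressed coordinates `f = (a, 0, c, d, e)`, `a ≠ 0`, and the involutions `N_φ` -/

/-- A form with `Δ ≠ 0` does not vanish at all of `[0:1], [±1:1], [±2:1]` (five distinct points,
`2 ≠ 0`, `3 ≠ 0`). [folklore] -/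
theorem exists_eval_ne_zero (h2 : (2 : K) ≠ 0) (h3 : (3 : K) ≠ 0) {f : BinaryQuartic K}
    (hΔ : f.disc ≠ 0) : ∃ x₀ : K, f.eval x₀ 1 ≠ 0 := by
  by_contra h
  push Not at h
  have e0 := h 0
  have e1 := h 1
  have em1 := h (-1)
  have e2 := h 2
  have em2 := h (-2)
  simp only [eval] at e0 e1 em1 e2 em2
  have h24 : (24 : K) ≠ 0 := by
    rw [show (24 : K) = 2 * 2 * 2 * 3 by norm_num]
    exact mul_ne_zero (mul_ne_zero (mul_ne_zero h2 h2) h2) h3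
  have h12 : (12 : K) ≠ 0 := by
    rw [show (12 : K) = 2 * 2 * 3 by norm_num]; exact mul_ne_zero (mul_ne_zero h2 h2) h3
  have he : f.e = 0 := by linear_combination e0
  have ha : f.a = 0 := by
    have : 24 * f.a = 0 := by linear_combination e2 + em2 - 4 * e1 - 4 * em1 + 6 * e0
    exact (mul_eq_zero.mp this).resolve_left h24
  have hc : f.c = 0 := by
    have : 2 * f.c = 0 := by linear_combination e1 + em1 - 2 * ha - 2 * e0
    exact (mul_eq_zero.mp this).resolve_left h2
  have hb : f.b = 0 := by
    have : 12 * f.b = 0 := by linear_combination e2 - em2 - 2 * e1 + 2 * em1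
    exact (mul_eq_zero.mp this).resolve_left h12
  have hd : f.d = 0 := by
    have : 2 * f.d = 0 := by linear_combination e1 - em1 - 2 * hb
    exact (mul_eq_zero.mp this).resolve_left h2
  apply hΔ
  simp [disc, ha, hb, hc, hd, he]

/-- **Depressed coordinates.** If `Δ(f) ≠ 0` (`2 ≠ 0`, `3 ≠ 0`) some `P ∈ GL₂(K)` carries `f` to a
form with `a ≠ 0` and `b = 0` (move a non-zero of `f` to `[1:0]`, then translate). [folklore] -/
theorem exists_twist_depressed (h2 : (2 : K) ≠ 0) (h3 : (3 : K) ≠ 0) {f : BinaryQuartic K}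
    (hΔ : f.disc ≠ 0) :
    ∃ P : Matrix (Fin 2) (Fin 2) K, P.det ≠ 0 ∧ (twist P f).a ≠ 0 ∧ (twist P f).b = 0 := by
  obtain ⟨x₀, hx₀⟩ := exists_eval_ne_zero h2 h3 hΔ
  have h4 : (4 : K) ≠ 0 := by
    rw [show (4 : K) = 2 * 2 by norm_num]; exact mul_ne_zero h2 h2
  set P₁ : Matrix (Fin 2) (Fin 2) K := !![x₀, 1; 1, 0] with hP₁def
  have hP₁ : P₁.det = -1 := by simp [hP₁def, Matrix.det_fin_two]
  set f₁ := twist P₁ f with hf₁def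
  have hf₁ : f₁ = f.subst P₁ := by simp [hf₁def, twist, hP₁]
  have ha₁ : f₁.a = f.eval x₀ 1 := by
    rw [hf₁]; simp [subst, eval, hP₁def]
  have ha₁' : f₁.a ≠ 0 := ha₁ ▸ hx₀
  set μ := -f₁.b / (4 * f₁.a) with hμ
  set P₂ : Matrix (Fin 2) (Fin 2) K := !![1, 0; μ, 1] with hP₂def
  have hP₂ : P₂.det = 1 := by simp [hP₂def, Matrix.det_fin_two]
  have hf₂ : twist P₂ f₁ = f₁.subst P₂ := by simp [twist, hP₂]
  have ha₂ : (twist P₂ f₁).a = f₁.a := by rw [hf₂]; simp [subst, hP₂def]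
  have hb₂ : (twist P₂ f₁).b = 4 * f₁.a * μ + f₁.b := by rw [hf₂]; simp [subst, hP₂def]
  refine ⟨P₂ * P₁, ?_, ?_, ?_⟩
  · rw [Matrix.det_mul, hP₁, hP₂]; norm_num
  · rw [twist_mul, ha₂]; exact ha₁'
  · rw [twist_mul, hb₂, hμ]; field_simp; ring

/-- In depressed coordinates, if `2c` is a root of the resolvent then `d = 0` (`a ≠ 0`, `3 ≠ 0`):
the resolvent at `2c` is `−27ad²`. [folklore] -/
theorem d_eq_zero_of_two_mul_c_mem_resolventRoots (h3 : (3 : K) ≠ 0) {f : BinaryQuartic K}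
    (ha : f.a ≠ 0) (hb : f.b = 0) (h : 2 * f.c ∈ resolventRoots f) : f.d = 0 := by
  have hR : (2 * f.c) ^ 3 - 3 * f.I * (2 * f.c) + f.J = 0 := h
  simp only [I, J, hb] at hR
  have h27 : (27 : K) ≠ 0 := by
    rw [show (27 : K) = 3 * 3 * 3 by norm_num]; exact mul_ne_zero (mul_ne_zero h3 h3) h3
  have : 27 * f.a * f.d ^ 2 = 0 := by linear_combination -hR
  rcases mul_eq_zero.mp this with h1 | h1
  · exact absurd h1 (mul_ne_zero h27 ha)
  · exact pow_eq_zero_iff (n := 2) (by norm_num) |>.mp h1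

/-- The stabilising involution attached to a root `φ` of the resolvent, in depressed coordinates
`f = (a, 0, c, d, e)`: `N_φ = (9ad, 6a(φ − 2c); (φ − 2c)(φ + c), −9ad)`, and `diag(1, −1)` in the
degenerate case `φ = 2c` (where `d = 0`). [folklore] -/
def nMatrix (f : BinaryQuartic K) (φ : K) : Matrix (Fin 2) (Fin 2) K :=
  if φ = 2 * f.c then !![1, 0; 0, -1]
  else !![9 * f.a * f.d, 6 * f.a * (φ - 2 * f.c); (φ - 2 * f.c) * (φ + f.c), -9 * f.a * f.d]

/-- `N_φ` has trace zero. [folklore] -/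
theorem nMatrix_one_one (f : BinaryQuartic K) (φ : K) : (nMatrix f φ) 1 1 = -(nMatrix f φ) 0 0 := by
  unfold nMatrix
  split_ifs <;> simp

/-- The resolvent in depressed coordinates (`b = 0`), multiplied out. [folklore] -/
theorem resolvent_eq_of_b_eq_zero {f : BinaryQuartic K} (hb : f.b = 0) {φ : K}
    (hφ : φ ∈ resolventRoots f) :
    φ ^ 3 - 3 * (12 * f.a * f.e + f.c ^ 2) * φ + (72 * f.a * f.c * f.e - 27 * f.a * f.d ^ 2
      - 2 * f.c ^ 3) = 0 := by
  have hR : φ ^ 3 - 3 * f.I * φ + f.J = 0 := hφ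
  simp only [I, J, hb] at hR
  linear_combination hR

/-- **`N_φ ∈ Stab(f)`** in depressed coordinates (`a ≠ 0`, `b = 0`, `Δ ≠ 0`, `φ` a root of the
resolvent): `det N_φ = −9a(φ² − I)(φ − 2c) ≠ 0` and `f((x,y)N_φ) = (det N_φ)² f`, an identity
modulo the resolvent with small integral certificates. [folklore] -/
theorem nMatrix_mem_stabilizerSet (h3 : (3 : K) ≠ 0) {f : BinaryQuartic K} (ha : f.a ≠ 0)
    (hb : f.b = 0) (hΔ : f.disc ≠ 0) {φ : K} (hφ : φ ∈ resolventRoots f) :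
    nMatrix f φ ∈ stabilizerSet f := by
  rw [mem_stabilizerSet_iff]
  unfold nMatrix
  split_ifs with hc
  · have hd : f.d = 0 := d_eq_zero_of_two_mul_c_mem_resolventRoots h3 ha hb (hc ▸ hφ)
    refine ⟨by simp [Matrix.det_fin_two], ?_⟩
    ext <;> simp [subst, Matrix.det_fin_two, hb, hd]
    ring
  · have hR := resolvent_eq_of_b_eq_zero hb hφ
    have hI : φ ^ 2 - f.I ≠ 0 := sq_sub_I_ne_zero h3 hΔ hφ
    have h9 : (9 : K) ≠ 0 := by
      rw [show (9 : K) = 3 * 3 by norm_num]; exact mul_ne_zero h3 h3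
    have hdet : (!![9 * f.a * f.d, 6 * f.a * (φ - 2 * f.c); (φ - 2 * f.c) * (φ + f.c), -9 * f.a * f.d] :
        Matrix (Fin 2) (Fin 2) K).det = -9 * f.a * (φ ^ 2 - f.I) * (φ - 2 * f.c) := by
      simp only [Matrix.det_fin_two, Matrix.of_apply, Matrix.cons_val', Matrix.cons_val_zero,
        Matrix.cons_val_one, Matrix.cons_val_fin_one, I, hb]
      linear_combination (3 * f.a) * hR
    refine ⟨?_, ?_⟩
    · rw [hdet]
      exact mul_ne_zero (mul_ne_zero (mul_ne_zero (neg_ne_zero.mpr h9) ha) hI) (sub_ne_zero.mpr hc)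
    · ext
      · simp only [subst, smul_a, Matrix.det_fin_two, Matrix.of_apply, Matrix.cons_val',
          Matrix.cons_val_zero, Matrix.cons_val_one, Matrix.cons_val_fin_one, hb]
        linear_combination (288 * f.a ^ 3 * f.c ^ 3 - 432 * f.a ^ 3 * f.c ^ 2 * φ
          + 216 * f.a ^ 3 * f.c * φ ^ 2 - 36 * f.a ^ 3 * φ ^ 3) * hR
      · simp only [subst, smul_b, Matrix.det_fin_two, Matrix.of_apply, Matrix.cons_val',
          Matrix.cons_val_zero, Matrix.cons_val_one, Matrix.cons_val_fin_one, hb]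
        linear_combination (864 * f.a ^ 3 * f.c ^ 2 * f.d - 864 * f.a ^ 3 * f.c * f.d * φ
          + 216 * f.a ^ 3 * f.d * φ ^ 2) * hR
      · simp only [subst, smul_c, Matrix.det_fin_two, Matrix.of_apply, Matrix.cons_val',
          Matrix.cons_val_zero, Matrix.cons_val_one, Matrix.cons_val_fin_one, hb]
        linear_combination (972 * f.a ^ 3 * f.c * f.d ^ 2 - 486 * f.a ^ 3 * f.d ^ 2 * φ) * hR
      · simp only [subst, smul_d, Matrix.det_fin_two, Matrix.of_apply, Matrix.cons_val',
          Matrix.cons_val_zero, Matrix.cons_val_one, Matrix.cons_val_fin_one, hb]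
        linear_combination (486 * f.a ^ 3 * f.d ^ 3) * hR
      · simp only [subst, smul_e, Matrix.det_fin_two, Matrix.of_apply, Matrix.cons_val',
          Matrix.cons_val_zero, Matrix.cons_val_one, Matrix.cons_val_fin_one, hb]
        linear_combination (-54 * f.a ^ 2 * f.c ^ 2 * f.d ^ 2 - 27 * f.a ^ 2 * f.c * f.d ^ 2 * φ
          + 27 * f.a ^ 2 * f.d ^ 2 * φ ^ 2 - 8 * f.a * f.c ^ 5 - 4 * f.a * f.c ^ 4 * φ
          + 10 * f.a * f.c ^ 3 * φ ^ 2 + f.a * f.c ^ 2 * φ ^ 3 - 4 * f.a * f.c * φ ^ 4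
          + f.a * φ ^ 5) * hR

/-- **`φ(N_φ) = φ`** in depressed coordinates. [folklore] -/
theorem phiOf_nMatrix (h2 : (2 : K) ≠ 0) (h3 : (3 : K) ≠ 0) {f : BinaryQuartic K} (ha : f.a ≠ 0)
    (hb : f.b = 0) (hΔ : f.disc ≠ 0) {φ : K} (hφ : φ ∈ resolventRoots f) :
    phiOf f (nMatrix f φ) = φ := by
  have h4 : (4 : K) ≠ 0 := by
    rw [show (4 : K) = 2 * 2 by norm_num]; exact mul_ne_zero h2 h2
  have hmem := nMatrix_mem_stabilizerSet h3 ha hb hΔ hφ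
  have hD : dInv (nMatrix f φ) ≠ 0 := by
    rw [dInv_eq_neg_det (nMatrix_one_one f φ)]; exact neg_ne_zero.mpr hmem.1
  rw [phiOf, div_eq_iff (mul_ne_zero h4 hD)]
  revert hD
  unfold nMatrix
  split_ifs with hc
  · intro _
    simp only [pairing12, hsq, dInv, Matrix.of_apply, Matrix.cons_val', Matrix.cons_val_zero,
      Matrix.cons_val_one, Matrix.cons_val_fin_one, hb, hc]
    ring
  · intro _
    have hR := resolvent_eq_of_b_eq_zero hb hφ
    simp only [pairing12, hsq, dInv, Matrix.of_apply, Matrix.cons_val', Matrix.cons_val_zero,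
      Matrix.cons_val_one, Matrix.cons_val_fin_one, hb]
    linear_combination (24 * f.a * f.c - 12 * f.a * φ) * hR

/-! ## Counting the classes -/

/-- Scaling does not change the class. [folklore] -/
theorem stabilizerClass_smul (f : BinaryQuartic K) {c : K} (hc : c ≠ 0) (γ : Matrix (Fin 2) (Fin 2) K) :
    stabilizerClass f (c • γ) = stabilizerClass f γ := by
  ext γ'
  simp only [stabilizerClass, Set.mem_setOf_eq]
  refine and_congr_right fun _ ↦ ⟨?_, ?_⟩
  · rintro ⟨c', rfl⟩; exact ⟨c' * c, by rw [smul_smul]⟩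
  · rintro ⟨c', rfl⟩; exact ⟨c' / c, by rw [smul_smul, div_mul_cancel₀ _ hc]⟩

/-- Equal classes of stabilising matrices mean proportional matrices. [folklore] -/
theorem exists_smul_of_stabilizerClass_eq {f : BinaryQuartic K} {γ γ' : Matrix (Fin 2) (Fin 2) K}
    (hγ' : γ' ∈ stabilizerSet f) (h : stabilizerClass f γ = stabilizerClass f γ') :
    ∃ c : K, c ≠ 0 ∧ γ' = c • γ := by
  have : γ' ∈ stabilizerClass f γ := by
    rw [h]; exact ⟨hγ', 1, by rw [one_smul]⟩
  obtain ⟨-, c, hc⟩ := this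
  exact ⟨c, ne_zero_of_smul_mem_stabilizerSet (hc ▸ hγ'), hc⟩

/-- The set of `K`-rational roots of the resolvent is finite (a nonzero cubic). [folklore] -/
theorem resolventRoots_finite (f : BinaryQuartic K) : (resolventRoots f).Finite := by
  classical
  let p : Cubic K := ⟨1, 0, -3 * f.I, f.J⟩
  have hp : p.toPoly ≠ 0 := Cubic.ne_zero_of_a_ne_zero one_ne_zero
  refine (p.roots.toFinset.finite_toSet).subset fun φ hφ ↦ ?_
  have hφ' : φ ^ 3 - 3 * f.I * φ + f.J = 0 := hφ
  rw [Finset.mem_coe, Multiset.mem_toFinset, Cubic.mem_roots_iff hp]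
  linear_combination hφ'

/-- The resolvent has at most three `K`-rational roots. [folklore] -/
theorem ncard_resolventRoots_le (f : BinaryQuartic K) : (resolventRoots f).ncard ≤ 3 := by
  classical
  let p : Cubic K := ⟨1, 0, -3 * f.I, f.J⟩
  have hp : p.toPoly ≠ 0 := Cubic.ne_zero_of_a_ne_zero one_ne_zero
  have hsub : resolventRoots f ⊆ p.roots.toFinset := fun φ hφ ↦ by
    have hφ' : φ ^ 3 - 3 * f.I * φ + f.J = 0 := hφ
    rw [Finset.mem_coe, Multiset.mem_toFinset, Cubic.mem_roots_iff hp]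
    linear_combination hφ'
  calc (resolventRoots f).ncard ≤ (p.roots.toFinset : Set K).ncard :=
        Set.ncard_le_ncard hsub (Finset.finite_toSet _)
    _ = p.roots.toFinset.card := Set.ncard_coe_finset _
    _ ≤ 3 := Cubic.card_roots_le

/-- **Bhargava–Shankar, Lemma 5.11 / Thm 3.2 of the published version, algebraic form: the
stabiliser of a binary quartic form in `PGL₂(K)` has `1 + #{K-rational roots of the cubic
resolvent}` elements** (`= #E_{I,J}(K)[2]`), for every field `K` with `2 ≠ 0`, `3 ≠ 0` and every
`f` with `Δ(f) ≠ 0`. [cite: BhargavaShankarAnnals2015, Lemma 5.11 (arXiv:1006.1002v2 numbering)] -/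
theorem pgl2StabilizerCard_eq (h2 : (2 : K) ≠ 0) (h3 : (3 : K) ≠ 0) {f : BinaryQuartic K}
    (hΔ : f.disc ≠ 0) : pgl2StabilizerCard f = 1 + (resolventRoots f).ncard := by
  obtain ⟨P, hP, ha, hb⟩ := exists_twist_depressed h2 h3 hΔ
  set f' := twist P f with hf'
  have hΔ' : f'.disc ≠ 0 := by rwa [hf', disc_twist h3 hP]
  have hroots : resolventRoots f' = resolventRoots f := resolventRoots_twist hP f
  have hPu : IsUnit P.det := isUnit_iff_ne_zero.mpr hP
  have hPinv : P⁻¹.det ≠ 0 := by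
    rw [Matrix.det_nonsing_inv, Ring.inverse_eq_inv']; exact inv_ne_zero hP
  -- pull back along `P`
  have hback : ∀ γ', γ' ∈ stabilizerSet f' → P⁻¹ * γ' * P ∈ stabilizerSet f := by
    intro γ' hγ'
    have h := (conj_mem_stabilizerSet_iff hPinv f' γ').mpr hγ'
    rwa [Matrix.nonsing_inv_nonsing_inv _ hPu, hf', twist_inv_twist hP] at h
  have hconjP : ∀ M : Matrix (Fin 2) (Fin 2) K, P * (P⁻¹ * M * P) * P⁻¹ = M := fun M ↦ by
    rw [Matrix.mul_assoc P⁻¹, ← Matrix.mul_assoc P, Matrix.mul_nonsing_inv _ hPu, Matrix.one_mul,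
      Matrix.mul_assoc, Matrix.mul_nonsing_inv _ hPu, Matrix.mul_one]
  have hconjP' : ∀ M : Matrix (Fin 2) (Fin 2) K, P⁻¹ * (P * M * P⁻¹) * P = M := fun M ↦ by
    rw [Matrix.mul_assoc P, ← Matrix.mul_assoc P⁻¹, Matrix.nonsing_inv_mul _ hPu, Matrix.one_mul,
      Matrix.mul_assoc, Matrix.nonsing_inv_mul _ hPu, Matrix.mul_one]
  -- representatives
  set R : K → Matrix (Fin 2) (Fin 2) K := fun φ ↦ P⁻¹ * nMatrix f' φ * P with hR
  have hN : ∀ φ ∈ resolventRoots f, nMatrix f' φ ∈ stabilizerSet f' := fun φ hφ ↦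
    nMatrix_mem_stabilizerSet h3 ha hb hΔ' (hroots ▸ hφ)
  have hRmem : ∀ φ ∈ resolventRoots f, R φ ∈ stabilizerSet f := fun φ hφ ↦ hback _ (hN φ hφ)
  have hRsmul : ∀ φ ∈ resolventRoots f, ∀ φ' ∈ resolventRoots f, ∀ c : K, c ≠ 0 →
      R φ' = c • R φ → φ' = φ := by
    intro φ hφ φ' hφ' c hc heq
    have heq' : nMatrix f' φ' = c • nMatrix f' φ := by
      have := congrArg (fun M ↦ P * M * P⁻¹) heq
      simpa only [hR, hconjP, Matrix.mul_smul, Matrix.smul_mul] using this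
    have h1 := phiOf_nMatrix h2 h3 ha hb hΔ' (hroots ▸ hφ')
    rw [heq', phiOf_smul hc, phiOf_nMatrix h2 h3 ha hb hΔ' (hroots ▸ hφ)] at h1
    exact h1.symm
  -- the set of classes
  have hclasses : stabilizerClass f '' stabilizerSet f =
      insert (stabilizerClass f 1) ((fun φ ↦ stabilizerClass f (R φ)) '' resolventRoots f) := by
    apply Set.Subset.antisymm
    · rintro _ ⟨γ, hγ, rfl⟩
      by_cases hsc : ∃ c : K, γ = c • (1 : Matrix (Fin 2) (Fin 2) K)
      · obtain ⟨c, rfl⟩ := hsc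
        exact Set.mem_insert_iff.mpr
          (Or.inl (stabilizerClass_smul f (ne_zero_of_smul_mem_stabilizerSet hγ) 1))
      · refine Set.mem_insert_iff.mpr (Or.inr ?_)
        have htr := trace_eq_zero_of_mem_stabilizerSet h2 h3 hΔ hγ hsc
        set γ₁ := P * γ * P⁻¹ with hγ₁
        have hγ₁mem : γ₁ ∈ stabilizerSet f' := (conj_mem_stabilizerSet_iff hP f γ).mpr hγ
        have htr₁ : γ₁ 1 1 = -γ₁ 0 0 := by
          have h1 : γ₁.trace = γ.trace := by
            rw [hγ₁, Matrix.trace_mul_cycle, Matrix.nonsing_inv_mul _ hPu, Matrix.one_mul]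
          rw [Matrix.trace_fin_two, Matrix.trace_fin_two] at h1
          linear_combination h1 + htr
        set φ := phiOf f' γ₁ with hφdef
        have hφ' : φ ∈ resolventRoots f' := (phiOf_spec h2 hγ₁mem htr₁).1
        have hφ : φ ∈ resolventRoots f := hroots ▸ hφ'
        obtain ⟨c, hc⟩ := exists_smul_eq_of_phiOf_eq h2 h3 hΔ' (hN φ hφ) (nMatrix_one_one f' φ)
          hγ₁mem htr₁ (by rw [phiOf_nMatrix h2 h3 ha hb hΔ' hφ'])
        have hc0 : c ≠ 0 := ne_zero_of_smul_mem_stabilizerSet (hc ▸ hγ₁mem)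
        refine ⟨φ, hφ, ?_⟩
        have hγeq : γ = c • R φ := by
          have : γ = P⁻¹ * γ₁ * P := by rw [hγ₁, hconjP']
          rw [this, hc, hR]
          simp only [Matrix.mul_smul, Matrix.smul_mul]
        rw [hγeq, stabilizerClass_smul f hc0]
    · intro S hS
      rcases Set.mem_insert_iff.mp hS with rfl | ⟨φ, hφ, rfl⟩
      · exact ⟨1, one_mem_stabilizerSet f, rfl⟩
      · exact ⟨R φ, hRmem φ hφ, rfl⟩
  rw [pgl2StabilizerCard, hclasses]
  have hfin : (resolventRoots f).Finite := resolventRoots_finite f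
  rw [Set.ncard_insert_of_notMem ?_ (hfin.image _), Set.InjOn.ncard_image ?_, add_comm]
  · intro φ hφ φ' hφ' heq
    obtain ⟨c, hc, hcc⟩ := exists_smul_of_stabilizerClass_eq (hRmem φ' hφ') heq
    exact (hRsmul φ hφ φ' hφ' c hc hcc).symm
  · rintro ⟨φ, hφ, heq⟩
    obtain ⟨c, hc, hcc⟩ := exists_smul_of_stabilizerClass_eq (one_mem_stabilizerSet f) heq
    -- `1 = c • R φ`, so `N_φ` is a scalar: contradiction
    have hN1 : nMatrix f' φ = c⁻¹ • (1 : Matrix (Fin 2) (Fin 2) K) := by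
      have := congrArg (fun M ↦ c⁻¹ • (P * M * P⁻¹)) hcc
      simpa only [hR, hconjP, Matrix.mul_smul, Matrix.smul_mul, smul_smul, inv_mul_cancel₀ hc,
        one_smul, Matrix.mul_one, Matrix.mul_nonsing_inv _ hPu] using this.symm
    exact not_scalar_of_trace_zero h2 (hN φ hφ) (nMatrix_one_one f' φ) ⟨c⁻¹, hN1⟩

/-- **At most four**: the stabiliser of a form with `Δ ≠ 0` in `PGL₂(K)` has at most `4` elements.
[cite: BhargavaShankarAnnals2015, Lemma 5.11 (arXiv:1006.1002v2 numbering)] -/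
theorem pgl2StabilizerCard_le_four (h2 : (2 : K) ≠ 0) (h3 : (3 : K) ≠ 0) {f : BinaryQuartic K}
    (hΔ : f.disc ≠ 0) : pgl2StabilizerCard f ≤ 4 := by
  rw [pgl2StabilizerCard_eq h2 h3 hΔ]
  have := ncard_resolventRoots_le f
  omega

end BinaryQuartic

end Literature.NumberTheory.EllipticCurves

end
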